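import Summits.BirchSwinnertonDyer.BirchSwinnertonDyer.Theses.GenusKolyvaginAtTwo
import Summits.BirchSwinnertonDyer.BirchSwinnertonDyer.Theorems.GenusKolyvaginAtTwoShaCardDvdPowAtTwoRTShaFiniteAtTwo
import Summits.BirchSwinnertonDyer.BirchSwinnertonDyer.Theorems.GenusKolyvaginAtTwoShaCardDvdPowAtTwoRTPairCount
import Summits.BirchSwinnertonDyer.BirchSwinnertonDyer.Theorems.GenusKolyvaginAtTwoShaCardDvdPowAtTwoRTSandwich
import HarnessLib

/-!
# LINE 19 `rational_pair_descent` — SKELETON v1.2 for the crux U_T `ShaCardDvdPowAtTwoRT` (stmt-BirchSwinnertonDyer-23658;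
# `#Ш(E/K)[2^∞] ∣ 2^(2M₀)` on the (D-NPh)/(β″) habitat), LEAD gk2-p1 g19, route `GenusKolyvaginAtTwo` rev 37, 2026-08-29T22:1xZ

STATUS v1.2 (2026-08-30T00:0xZ).  **The live branch is SORRY-FREE**: PAIRCOUNT `stub_shaRatCardDvdOfMinimalTwin` is CLOSED by name
(gk2-p4 g22, `Theorems/…RTPairCount.lean`, from B2Q p748779 + RANKQ p749000 + CTQ p748034) and SANDWICH′ `stub_sandwichOfMinimalTwin` is CLOSED by
name (this seat, `Theorems/…RTSandwich.lean` = assembly `…RTSandwichAssembly` + (R′)/(A) `…RTAntiSymmetrisation` + «invariant classes are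
restrictions» `…RTInvariantClassesDescend` + Kramer class `…RTRestrictionKernelNontrivial`).  The ONLY remaining `sorry` is the declared residual
`stub_residualOffMinimalTwin` (U_T verbatim OFF the live configuration: no 2-Selmer-minimal globally minimal twin with `ord₂ c(Wd) ≤ 1`, or
`w(E) ≠ 1`), which this line does not claim; recommended repair (R7-d, to the route pen): restate U_T / Q3R_T onto the cut.

THE CUT (LEAD ruling R7, memo `Lines/rational-pair-descent-lead-g19.md`).  On the route's LIVE configuration — the twin `E^(d_K)` is
2-SELMER-MINIMAL (`#Sel₂(Wd) = 2`, the supply crux's output) — one has `Ш(E^(d_K)/ℚ)[2^∞] = 0`, hence `(1 − τ)·Ш(E/K)[2^∞] =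
res′(cores′ Ш(E/K)[2^∞]) = 0`: complex conjugation acts TRIVIALLY on `X := Ш(E/K)[2^∞]`, every class of `X` is the restriction of a
class of `Ш^rel(E/ℚ)[2^∞]` (relaxed exactly at the ramified primes of `K`; inf–res with `E(ℚ)/N E(K)` of odd order), every class has a
`τ`-invariant Selmer lift, and EVERY `K`-side Kolyvagin Cassels–Tate certificate loses its bit (gk2-p3 g25 p741863): McCallum's count
must be run over `ℚ`, for the rank-zero curve `E` alone, where the local frames at inert Kolyvagin primes are CYCLIC (`Δ < 0`) and the
descended margin-one classes are honest Selmer classes at the ramified primes (gk2-p3 g25 p743740).  The count over `ℚ` is the CM cell's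
ADAPTIVE TELESCOPE `Summit….Theorems.CMKolyvaginAtInertTwoAdaptiveDataTelescope.card_mul_card_le_of_casselsTate_adaptive` (T4 over
`KolyvaginDescent.SplitDataM`, any `p`, non-vacuous at `2`) with `Zp = ⊥` — so its independence hypothesis (IND) is automatic.

STUBS (sorries ONLY in `stub_*`; `ShaCardDvdPowAtTwoRT_of_stubs` concludes the crux BY NAME):
* PAIRCOUNT `stub_shaRatCardDvdOfMinimalTwin` (L; Kolyvagin over `ℚ` AT 2 for the rank-zero member: `#Ш(E/ℚ)[2^∞] ∣ 4^M₀` on the live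
  configuration).  v1.1 ROAD (memo §2′, NO telescope): (B2Q) SHARP EXPONENT `2^M₀ · Sel_(2^M)(E/ℚ) = 0` — Kolyvagin's Thm B₂ at `l = 2` = ONE
  Kolyvagin prime per Selmer class, Poitou–Tate reciprocity over `ℚ` (LINE 6 `…ReciprocityRat`), CYCLIC local duality over `ℚ_ℓ` on `Δ < 0`
  (`…Lemma53Rat`, g25 §13), the `ℚ`-descended class `c_M(ℓ)` Selmer at `q ∣ d_K` (margin one, g25 p743740), its singular order from Q2
  (`…PropFourFourRat`), mixed-pair Čebotarev (`…MixedPairChebotarev` / `…CebotarevVisibleRat`); (RANKQ) `dim Ш(E/ℚ)[2] = dim Sel₂(E) ≤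
  dim Sel₂(Wd) + 1 = 2` (the two Selmer structures differ at ONE place, the transposition prime; `ord₂ c(Wd) ≤ 1`); (CTQ) `Ш(E/ℚ)[2^∞]` finite
  (⟸ FIN + finite restriction kernel) with alternating perfect Cassels–Tate pairing ⟹ `≅ (ℤ/2^t′)²` or `0`, `t′ ≤ M₀` by (B2Q).  The adaptive
  telescope T4 (`card_mul_card_le_of_casselsTate_adaptive`, `Zp = ⊥`) remains the road for `ord₂ c(Wd) ≥ 3` (residual).
* SANDWICH `stub_sandwichOfMinimalTwin` (M; LEAD) — v1.1 form with ONE bit of slack (the square refund in the composition absorbs it):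
  `#Ш(E/K)[2^∞] ∣ 2 · #Ш(E/ℚ)[2^∞]` on the live configuration (`w(E) = 1`, 2-Selmer-minimal twin, `ord₂ c(Wd) ≤ 1`).  Road (memo §1, finite
  level `2^L`, `L = M₀ + 3`): `#X = [X : X^τ] · #X^τ`; `[X : X^τ] ≤ #(S′_ℚ/δ′E^(d)(ℚ)) ≤ 2^DEF = 2` via `s ↦ res′⁻¹(s − τ_* s)`
  (finite-level inf–res for the twist, LINE 6 `…QuadInfResTwist`; `Ш(E^(d))[2] = 0`); `X^τ` = image of `Sel_K^τ = res S_ℚ` once every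
  τ-fixed class of `Ш(E/K)[2^∞]` has a τ-INVARIANT Selmer lift (index-2 inf–res with `Ĥ⁰(C₂, E(K)) = E(ℚ)/N E(K) = 0`, `E(ℚ)` odd torsion
  — the one generic brick to add, this seat), `#S_ℚ ≤ #Ш(E/ℚ)[2^L] · 2^DEF`, `(δ_K E(K))^τ` of order 2.
* RESIDUAL `stub_residualOffMinimalTwin` (declared residual, BSD-true, no mechanism): U_T verbatim OFF the live configuration
  (no 2-Selmer-minimal globally minimal twin model with `ord₂ c(Wd) ≤ 1`).  Pen: restating U_T/Q3R_T onto the cut {twin minimal ∧ `|d_K|` prime}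
  (free for `closes`, which gets `K`, `Wd`, `#Sel₂(Wd) = 2` from hPG and can ask the supply for a prime `|d_K|`) deletes this stub.
* FIN is a THEOREM (gk2-p5 g29 p746739 `finite_primaryComponent_sha_two_onHabitat`), consumed by the composition (`#X = 4^t`), not a stub.
BSD is NOT proved by any of this; U_T is NOT proved; nothing is closed.

References: [McCallumLMS1991] §5 Thm. 5.4, Cor. 5.6, Prop. 4.7, Lemma 5.3; [Kolyvagin1989Izv] Thm. B₂, §3 (the pair over ℚ);
[Kolyvagin1990] Thm. A; [GrossLMS1991] §5 Prop. 5.4, §10; [Kramer1981] Thm. 1–2, Prop. 3; [MilneADT2006] I §6.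
-/

set_option linter.dupNamespace false
set_option autoImplicit false

noncomputable section

namespace Summit.BirchSwinnertonDyer.BirchSwinnertonDyer.Cruxes.ShaCardDvdPowAtTwoRT.RationalPairDescent

open scoped Classical
open WeierstrassCurve NumberField IsDedekindDomain Field
open Literature.NumberTheory.GaloisRepresentations Literature.NumberTheory.EllipticCurves
open Literature.NumberTheory
open Summit.BirchSwinnertonDyer.BirchSwinnertonDyer.Theses.GenusKolyvaginAtTwo
open Summit.BirchSwinnertonDyer.BirchSwinnertonDyer.Theorems.GenusExact.PlusDescent

-- FIN is CLOSED (gk2-p5 g29 p746739 `finite_primaryComponent_sha_two_onHabitat`); it enters the composition through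
-- `exists_natCard_primaryComponent_sha_two_eq_pow_two_mul_onHabitat` (`#Ш(E/K)[2^∞] = 4^t`).

/-- stub PAIRCOUNT (L) — **Kolyvagin over `ℚ` at `2` for the rank-zero member**: on U_T's frame with `w(E) = 1` and a 2-Selmer-minimal globally
minimal twin model `Wd ≅ E^(d_K)` with `ord₂ c(Wd) ≤ 1`, `#Ш(E/ℚ)[2^∞] ∣ 2^(2M₀)`.  Road (memo §2′): SHARP EXPONENT `2^M₀·Ш(E/ℚ)[2^∞] = 0`
(Kolyvagin's Thm B₂ at `l = 2`: one deep Kolyvagin prime per Selmer class, reciprocity over `ℚ`, CYCLIC local duality over `ℚ_ℓ` on `Δ < 0`,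
margin-one descended class Selmer at the ramified prime, Q2 for the singular order) + RANK `dim Ш(E/ℚ)[2] ≤ dim Sel₂(Wd) + 1 = 2` (Selmer
structures of `E`, `E^(d)` differ at one place) + Cassels–Tate structure `(ℤ/2^t′)²`.  Why it might fail: the mixed Čebotarev prescription (one
E^(d)-type class and one E-type class both of FULL order at the same prime) must avoid the Lawson–Wuthrich phantom at `ℚ(E[4])` (NPh at the
multiplicative prime applies to both classes); the real place in the `ℚ`-side reciprocity (silent on `Δ < 0`).
[cite: McCallumLMS1991, §5 Thm. 5.4, Cor. 5.6] [cite: Kolyvagin1989Izv, Thm. B₂, §3] [cite: Kolyvagin1990, Thm. A] -/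
theorem stub_shaRatCardDvdOfMinimalTwin :
    KolyvaginRelationAtTwo → EquivariantChebotarevAtTwoR → (∀ (W : WeierstrassCurve ℚ) [W.IsElliptic], W.Δ < 0 → ∀ (c₀ : Field.absoluteGaloisGroup ℚ), Literature.NumberTheory.GaloisRepresentations.IsComplexConjugation (Rat.castHom ℝ) c₀ → ∀ (M : ℕ), ∃ P : W.geomTorsion ((2 ^ M : ℕ) : ℤ), ∀ Q : W.geomTorsion ((2 ^ M : ℕ) : ℤ), ∃ a b : ℤ, Q = a • P + b • (c₀ • P)) → ∀ (W : WeierstrassCurve ℚ) [W.IsElliptic] [W.IsGloballyMinimal] [NeZero (W.conductorNorm ℤ)], ¬ W.HasCM → Odd W.tamagawaProduct → ∀ (v : IsDedekindDomain.HeightOneSpectrum (NumberField.RingOfIntegers ℚ)), ((2 : ℕ) : NumberField.RingOfIntegers ℚ) ∉ v.asIdeal → ((W.conductorNorm ℤ : ℕ) : NumberField.RingOfIntegers ℚ) ∈ v.asIdeal → W.HasMultiplicativeReductionAt v → W.Δ < 0 → ∀ (K : Type) [Field K] [NumberField K], Literature.NumberTheory.EllipticCurves.IsImaginaryQuadratic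 K → Odd (NumberField.discr K) → NumberField.discr K ≠ -3 → Literature.NumberTheory.EllipticCurves.SatisfiesHeegnerHypothesis (W.conductorNorm ℤ) K → ¬ IsSquare ((NumberField.discr K : ℚ) * -|W.Δ|) → ¬ IsSquare ((NumberField.discr K : ℚ) * (-(2 * |W.Δ|))) → (∀ n : ℕ, 0 < n → W.HasSurjectiveModNGaloisRep ((2 : ℤ) ^ n)) → ∀ (Dt : Literature.NumberTheory.EllipticCurves.ModularForms.ModularParametrizationData W (W.conductorNorm ℤ)) (β : ℤ) (ι : K →+* ℂ) (d₁ : Literature.NumberTheory.EllipticCurves.KolyvaginHeegnerData Dt β ι 1), ¬ IsOfFinAddOrder d₁.derivedPoint → ∀ (M₀ : ℕ), (∃ Q : (W.baseChange (Literature.NumberTheory.EllipticCurves.ringClassField K ι 1)).toAffine.Point, ((2 ^ M₀ : ℕ) : ℤ) • Q = d₁.derivedPoint) → (¬ ∃ Q : (W.baseChange (Literature.NumberTheory.EllipticCurves.ringClassField K ι 1)).toAffine.Point, ((2 ^ (M₀ + 1) : ℕ) : ℤ) • Q = d₁.derivedPoint) →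
      W.rootNumber = 1 → ∀ (Wd : WeierstrassCurve ℚ) [Wd.IsElliptic] [Wd.IsGloballyMinimal],
        (∃ C : WeierstrassCurve.VariableChange ℚ, C • W.quadraticTwist (NumberField.discr K : ℚ) = Wd) →
        Nat.card (Wd.selmerGroup 2) = 2 → padicValNat 2 Wd.tamagawaProduct ≤ 1 →
        Nat.card (AddCommGroup.primaryComponent W.sha 2) ∣ 2 ^ (2 * M₀) :=
  -- CLOSED by name (Theorems file); kept here so the registered stub list is unchanged
  Summit.BirchSwinnertonDyer.BirchSwinnertonDyer.Theorems.GenusExact.RationalPairDescent.stub_shaRatCardDvdOfMinimalTwin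

/-- stub SANDWICH (M, LEAD) — **the structural count under a 2-Selmer-minimal twin, with one bit of slack**: on U_T's frame with `w(E) = 1`
and a 2-Selmer-minimal globally minimal twin model `Wd ≅ E^(d_K)` with `ord₂ c(Wd) ≤ 1`: `#Ш(E/K)[2^∞] ∣ 2 · #Ш(E/ℚ)[2^∞]`.
Road (memo §1, finite level `2^L`): `[X : X^τ] ≤ 2` by the map `s ↦ res′⁻¹(s − τ_* s)` into the level-`2^L` relaxed Selmer group of `E^(d)`
modulo `δ′ E^(d)(ℚ)` (order `≤ 2^DEF = 2` since `Ш(E^(d))[2] = 0`); every τ-fixed class of `X` has a τ-INVARIANT Selmer lift (index-2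
inflation–restriction for `E(K̄)` with `Ĥ⁰(C₂, E(K)) = E(ℚ)/N E(K) = 0`, `E(ℚ)` odd torsion); `Sel_K^τ = res S_ℚ`, `#S_ℚ ≤ 2^DEF·#Ш(E/ℚ)[2^L]`,
`#(δ_K E(K))^τ = 2`.  The exact form `#X ∣ #Ш(E/ℚ)[2^∞]` needs in addition `τ = id` on `X` (corestriction commuting with localisation —
not in the tree for a general `E`); the composition does not need it.  Why it might fail: plumbing only.
[cite: Kramer1981, Thm. 1, Prop. 3] [cite: MilneADT2006, I §6] [cite: GrossLMS1991, §5 Prop. 5.3] -/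
theorem stub_sandwichOfMinimalTwin :
    KolyvaginRelationAtTwo → EquivariantChebotarevAtTwoR → (∀ (W : WeierstrassCurve ℚ) [W.IsElliptic], W.Δ < 0 → ∀ (c₀ : Field.absoluteGaloisGroup ℚ), Literature.NumberTheory.GaloisRepresentations.IsComplexConjugation (Rat.castHom ℝ) c₀ → ∀ (M : ℕ), ∃ P : W.geomTorsion ((2 ^ M : ℕ) : ℤ), ∀ Q : W.geomTorsion ((2 ^ M : ℕ) : ℤ), ∃ a b : ℤ, Q = a • P + b • (c₀ • P)) → ∀ (W : WeierstrassCurve ℚ) [W.IsElliptic] [W.IsGloballyMinimal] [NeZero (W.conductorNorm ℤ)], ¬ W.HasCM → Odd W.tamagawaProduct → ∀ (v : IsDedekindDomain.HeightOneSpectrum (NumberField.RingOfIntegers ℚ)), ((2 : ℕ) : NumberField.RingOfIntegers ℚ) ∉ v.asIdeal → ((W.conductorNorm ℤ : ℕ) : NumberField.RingOfIntegers ℚ) ∈ v.asIdeal → W.HasMultiplicativeReductionAt v → W.Δ < 0 → ∀ (K : Type) [Field K] [NumberField K], Literature.NumberTheory.EllipticCurves.IsImaginaryQuadratic K → Odd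 (NumberField.discr K) → NumberField.discr K ≠ -3 → Literature.NumberTheory.EllipticCurves.SatisfiesHeegnerHypothesis (W.conductorNorm ℤ) K → ¬ IsSquare ((NumberField.discr K : ℚ) * -|W.Δ|) → ¬ IsSquare ((NumberField.discr K : ℚ) * (-(2 * |W.Δ|))) → (∀ n : ℕ, 0 < n → W.HasSurjectiveModNGaloisRep ((2 : ℤ) ^ n)) → ∀ (Dt : Literature.NumberTheory.EllipticCurves.ModularForms.ModularParametrizationData W (W.conductorNorm ℤ)) (β : ℤ) (ι : K →+* ℂ) (d₁ : Literature.NumberTheory.EllipticCurves.KolyvaginHeegnerData Dt β ι 1), ¬ IsOfFinAddOrder d₁.derivedPoint → ∀ (M₀ : ℕ), (∃ Q : (W.baseChange (Literature.NumberTheory.EllipticCurves.ringClassField K ι 1)).toAffine.Point, ((2 ^ M₀ : ℕ) : ℤ) • Q = d₁.derivedPoint) → (¬ ∃ Q : (W.baseChange (Literature.NumberTheory.EllipticCurves.ringClassField K ι 1)).toAffine.Point, ((2 ^ (M₀ + 1) : ℕ) : ℤ) • Q = d₁.derivedPoint) →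
      W.rootNumber = 1 → ∀ (Wd : WeierstrassCurve ℚ) [Wd.IsElliptic] [Wd.IsGloballyMinimal],
        (∃ C : WeierstrassCurve.VariableChange ℚ, C • W.quadraticTwist (NumberField.discr K : ℚ) = Wd) →
        Nat.card (Wd.selmerGroup 2) = 2 → padicValNat 2 Wd.tamagawaProduct ≤ 1 →
        Nat.card (AddCommGroup.primaryComponent (W.baseChange K).sha 2) ∣
          2 * Nat.card (AddCommGroup.primaryComponent W.sha 2) :=
  -- CLOSED by name (Theorems file); kept here so the registered stub list is unchanged
  Summit.BirchSwinnertonDyer.BirchSwinnertonDyer.Theorems.GenusExact.RationalPairDescent.stub_sandwichOfMinimalTwin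

/-- stub RESIDUAL (declared residual; BSD-true; no mechanism in the cell) — U_T VERBATIM off the route's live configuration: if NO globally
minimal model `Wd` of `E^(d_K)` is 2-Selmer-minimal with `ord₂ c(Wd) ≤ 1` (on `Δ < 0` the ramified part of `ord₂ c(Wd)` is ODD, so this
reads: twin not minimal, OR at least three transposition / a totally split prime divide `d_K`), then `#Ш(E/K)[2^∞] ∣ 2^(2M₀)`.  The `ℚ`-pair count
gives only `∣ 2^(2M₀ + ord₂ c(Wd) − 1)` there; the missing input is a level-one reciprocity between the relaxed classes of `E` at the ramified primes
and the corestriction cokernel on the `E^(d)` side (memo §4: BSD-consistent as `a = 1 + b′`).  Recommended repair: restate U_T onto the cut.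
[cite: GrossLMS1991, Conj. 1.2 / Thm. 1.3] [cite: Kramer1981, Thm. 1] -/
theorem stub_residualOffMinimalTwin :
    KolyvaginRelationAtTwo → EquivariantChebotarevAtTwoR → (∀ (W : WeierstrassCurve ℚ) [W.IsElliptic], W.Δ < 0 → ∀ (c₀ : Field.absoluteGaloisGroup ℚ), Literature.NumberTheory.GaloisRepresentations.IsComplexConjugation (Rat.castHom ℝ) c₀ → ∀ (M : ℕ), ∃ P : W.geomTorsion ((2 ^ M : ℕ) : ℤ), ∀ Q : W.geomTorsion ((2 ^ M : ℕ) : ℤ), ∃ a b : ℤ, Q = a • P + b • (c₀ • P)) → ∀ (W : WeierstrassCurve ℚ) [W.IsElliptic] [W.IsGloballyMinimal] [NeZero (W.conductorNorm ℤ)], ¬ W.HasCM → Odd W.tamagawaProduct → ∀ (v : IsDedekindDomain.HeightOneSpectrum (NumberField.RingOfIntegers ℚ)), ((2 : ℕ) : NumberField.RingOfIntegers ℚ) ∉ v.asIdeal → ((W.conductorNorm ℤ : ℕ) : NumberField.RingOfIntegers ℚ) ∈ v.asIdeal → W.HasMultiplicativeReductionAt v → W.Δ < 0 → ∀ (K :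 Type) [Field K] [NumberField K], Literature.NumberTheory.EllipticCurves.IsImaginaryQuadratic K → Odd (NumberField.discr K) → NumberField.discr K ≠ -3 → Literature.NumberTheory.EllipticCurves.SatisfiesHeegnerHypothesis (W.conductorNorm ℤ) K → ¬ IsSquare ((NumberField.discr K : ℚ) * -|W.Δ|) → ¬ IsSquare ((NumberField.discr K : ℚ) * (-(2 * |W.Δ|))) → (∀ n : ℕ, 0 < n → W.HasSurjectiveModNGaloisRep ((2 : ℤ) ^ n)) → ∀ (Dt : Literature.NumberTheory.EllipticCurves.ModularForms.ModularParametrizationData W (W.conductorNorm ℤ)) (β : ℤ) (ι : K →+* ℂ) (d₁ : Literature.NumberTheory.EllipticCurves.KolyvaginHeegnerData Dt β ι 1), ¬ IsOfFinAddOrder d₁.derivedPoint → ∀ (M₀ : ℕ), (∃ Q : (W.baseChange (Literature.NumberTheory.EllipticCurves.ringClassField K ι 1)).toAffine.Point, ((2 ^ M₀ : ℕ) : ℤ) • Q = d₁.derivedPoint) → (¬ ∃ Q : (W.baseChange (Literature.NumberTheory.EllipticCurves.ringClassField K ι 1)).toAffine.Point, ((2 ^ (M₀ + 1) : ℕ)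 : ℤ) • Q = d₁.derivedPoint) → ∀ (n : ℕ) (d : Literature.NumberTheory.EllipticCurves.KolyvaginHeegnerData Dt β ι n), Squarefree n → (∀ ℓ ∈ n.primeFactors, Literature.NumberTheory.EllipticCurves.Zhang2014.IsKolyvaginPrime (W.conductorNorm ℤ) W K 2 ℓ ∧ 2 ≤ Literature.NumberTheory.EllipticCurves.Zhang2014.kolyvaginIndex W 2 ℓ ∧ Literature.NumberTheory.EllipticCurves.FrobEqFrobInfty W K 2 ℓ) → (¬ ∃ Q : (W.baseChange (Literature.NumberTheory.EllipticCurves.ringClassField K ι n)).toAffine.Point, (2 : ℤ) • Q = d.derivedPoint) →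
      (¬ (W.rootNumber = 1 ∧ ∃ (Wd : WeierstrassCurve ℚ) (_ : Wd.IsElliptic) (_ : Wd.IsGloballyMinimal),
        (∃ C : WeierstrassCurve.VariableChange ℚ, C • W.quadraticTwist (NumberField.discr K : ℚ) = Wd) ∧
        Nat.card (Wd.selmerGroup 2) = 2 ∧ padicValNat 2 Wd.tamagawaProduct ≤ 1)) →
      Nat.card (AddCommGroup.primaryComponent (W.baseChange K).sha 2) ∣ 2 ^ (2 * M₀) := by
  sorry

/-- **Composition (kernel-checked; v1.2: the only `sorry` left is the declared residual stub)**: U_T `ShaCardDvdPowAtTwoRT` (stmt-BirchSwinnertonDyer-23658) BY NAME.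
On the live configuration (a 2-Selmer-minimal globally minimal twin model `Wd` with `ord₂ c(Wd) ≤ 1`): PAIRCOUNT `#Ш(E/ℚ)[2^∞] ∣ 4^M₀` and
SANDWICH `2·#Ш(E/K)[2^∞] ∣ #Ш(E/ℚ)[2^∞]·2^(ord₂ c(Wd))` give `2·#Ш(E/K)[2^∞] ∣ 2·4^M₀`; off it, RESIDUAL.
[cite: McCallumLMS1991, §5 Cor. 5.6] [cite: Kramer1981, Thm. 1] -/
theorem ShaCardDvdPowAtTwoRT_of_stubs : ShaCardDvdPowAtTwoRT := by
  intro hQ2 hQ5R hQ1 W _ _ _ hcm hT v h2v hNv hmult hneg K _ _ hIQ hodd h3 hHe hsq1 hsq2 hρ Dt β ι d₁ hy M₀ hdiv hndiv n d hn hKoly hPn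
  by_cases hmin : W.rootNumber = 1 ∧ ∃ (Wd : WeierstrassCurve ℚ) (_ : Wd.IsElliptic) (_ : Wd.IsGloballyMinimal),
      (∃ C : WeierstrassCurve.VariableChange ℚ, C • W.quadraticTwist (NumberField.discr K : ℚ) = Wd) ∧
      Nat.card (Wd.selmerGroup 2) = 2 ∧ padicValNat 2 Wd.tamagawaProduct ≤ 1
  · obtain ⟨hw, Wd, _, _, hWd, hSel, hDEF⟩ := hmin
    have hpair := stub_shaRatCardDvdOfMinimalTwin hQ2 hQ5R hQ1 W hcm hT v h2v hNv hmult hneg K hIQ hodd h3 hHe hsq1 hsq2 hρ Dt β ι d₁ hy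
      M₀ hdiv hndiv hw Wd hWd hSel hDEF
    have hsand := stub_sandwichOfMinimalTwin hQ2 hQ5R hQ1 W hcm hT v h2v hNv hmult hneg K hIQ hodd h3 hHe hsq1 hsq2 hρ Dt β ι d₁ hy
      M₀ hdiv hndiv hw Wd hWd hSel hDEF
    -- `#X ∣ 2 · #Ш(E/ℚ)[2^∞] ∣ 2 · 4^M₀` and `#X = 4^t` (finite `2`-group + Cassels–Tate squareness, below) ⟹ `t ≤ M₀`
    have hX : Nat.card (AddCommGroup.primaryComponent (W.baseChange K).sha 2) ∣ 2 * 2 ^ (2 * M₀) :=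
      hsand.trans (Nat.mul_dvd_mul_left 2 hpair)
    obtain ⟨t, ht⟩ := exists_natCard_primaryComponent_sha_two_eq_pow_two_mul_onHabitat hQ2 W hcm hT v h2v hNv hmult hneg K hIQ hodd h3 hHe hsq1 hsq2 hρ Dt β ι d₁ M₀ hndiv
    rw [ht] at hX ⊢
    rw [show 2 * 2 ^ (2 * M₀) = 2 ^ (2 * M₀ + 1) by ring] at hX
    have htM : 2 * t ≤ 2 * M₀ + 1 := (Nat.pow_dvd_pow_iff_le_right (by norm_num)).mp hX
    exact Nat.pow_dvd_pow 2 (by omega)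
  · exact stub_residualOffMinimalTwin hQ2 hQ5R hQ1 W hcm hT v h2v hNv hmult hneg K hIQ hodd h3 hHe hsq1 hsq2 hρ Dt β ι d₁ hy M₀ hdiv
      hndiv n d hn hKoly hPn hmin

end Summit.BirchSwinnertonDyer.BirchSwinnertonDyer.Cruxes.ShaCardDvdPowAtTwoRT.RationalPairDescent

end
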